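import Literature.Probability.RandomPlanarGeometry.SAWPulledLargeForceExpansionZdFirstOrder
import HarnessLib

/-!
# The pulled self-avoiding walk on `ℤ^{d+1}` at large force: THE THIRD COEFFICIENT `c^{(d)}_3 = 2d(2d+1)` —
# `e^{λ_B(y)} = y + 2d − 2d/y + 2d(2d+1)/y² + O(1/y³)` in every dimension

Topic `Literature/Probability/RandomPlanarGeometry` (continues `SAWPulledLargeForceExpansionZdFirstOrder.lean`).

Printed sources: E. J. Janse van Rensburg, S. G. Whittington, J. Phys. A 46 (2013) 435003, §3.2 Theorem 8 (first order, square lattice).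
The third coefficient in general dimension is not in print (lane «pcv-sawmu»).

## Contents (all PROVED, standard axioms only; no data, no certificates)

* generic (`namespace CostSeries`): the moments `pS c = P_c(1)`, `pD c = P_c'(1)`, `pH c = P_c''(1)/2` of the cost data; low coefficients of
  powers and compositions (`coeff_pow_low`, `coeff_Pz_comp_zero/one/two`), the coefficients of `A_1`, `A_2`, and
  ★ `e_three : e_3 = pD₁(pD₁ pS₁ − pS₂) + pH₁ pS₁² − pD₂ pS₁ + pS₃ + 2 pS₁ (pS₂ − pD₁ pS₁) + pS₁³`.
* combinatorics on `ℤ^{d+1}`: the cost-three irreducible bridges are exactly the `2d(2d−1)²` four-step walks `(0, e₀, e₀+v₁, e₀+v₁+v₂, e₀+v₁+v₂+v₃)`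
  with transverse unit steps and no immediate reversal (`fourStep…`), and there is none of length five (`costCoeffZd_three_five`, eight height
  patterns: four renewals, four revisits); ★ `costCoeffZd_three`.
* ★★ **`largeForceCoeffZd_at_three : largeForceCoeffZd d 3 = 2d(2d+1)`** (`ℤ²`: `largeForceCoeff_three_eq_six`), and
  ★★ `exp_pulledBridgeFreeEnergy_third_order_zd : |e^{λ_B(y)} − (y + 2d − 2d/y + 2d(2d+1)/y²)| ≤ C/y³`.
* analyticity at `y = ∞` in every dimension (the `ℤ^{d+1}` twin of `SAWPulledLargeForceExpansionConvergence`): `largeForceSeriesZd`,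
  `largeForceSeriesZd_radius_pos`, ★★ `analyticAt_largeForceSeriesZd_sum` (`g_d` analytic at `0`, `g_d(1/y) = e^{λ_B(y)}/y`),
  ★★ `analyticAt_pulledBridgeFreeEnergy_sub_log_zd` (`λ_B(y) − log y` analytic in `1/y`, vanishing at `∞`).

Provenance: lane «pcv-sawmu», a-p3 g15 (2026-08-24).
-/

noncomputable section

open Finset Filter Topology
open scoped BigOperators
open Literature.Probability.LatticeModels
open Literature.Probability.RandomPlanarGeometry.SAW

namespace Literature.Probability.RandomPlanarGeometry.SAW.Zd

namespace CostSeries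

variable (N : ℕ → ℕ → ℕ)

/-- `pS c = P_c(1) = Σ_n N_{c,n}`. [cite: JansevanRensburgWhittington2013, §3.2 Theorem 8 (arXiv v4 p. 11)] -/
def pS (c : ℕ) : ℤ := ∑ n ∈ Finset.range (2 * c + 2), (N c n : ℤ)

/-- `pD c = P_c'(1) = Σ_n n N_{c,n}`. [cite: JansevanRensburgWhittington2013, §3.2 Theorem 8 (arXiv v4 p. 11)] -/
def pD (c : ℕ) : ℤ := ∑ n ∈ Finset.range (2 * c + 2), (n : ℤ) * N c n

/-- `pH c = P_c''(1)/2 = Σ_n C(n,2) N_{c,n}`. [cite: JansevanRensburgWhittington2013, §3.2 Theorem 8 (arXiv v4 p. 11)] -/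
def pH (c : ℕ) : ℤ := ∑ n ∈ Finset.range (2 * c + 2), (n.choose 2 : ℤ) * N c n

/-- The coefficients `0, 1, 2` of `p^n` when `p(0) = 1`: `1`, `n p₁`, `n p₂ + C(n,2) p₁²`. [cite: JansevanRensburgWhittington2013, §3.2 Theorem 8 (arXiv v4 p. 11)] -/
theorem coeff_pow_low (p : Polynomial ℤ) (h0 : p.coeff 0 = 1) (n : ℕ) :
    (p ^ n).coeff 0 = 1 ∧ (p ^ n).coeff 1 = n * p.coeff 1 ∧ (p ^ n).coeff 2 = n * p.coeff 2 + (n.choose 2 : ℤ) * p.coeff 1 ^ 2 := by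
  induction n with
  | zero => simp [Polynomial.coeff_one]
  | succ n ih =>
    obtain ⟨i0, i1, i2⟩ := ih
    rw [pow_succ]
    refine ⟨?_, ?_, ?_⟩
    · rw [Polynomial.mul_coeff_zero, i0, h0, mul_one]
    · rw [Polynomial.coeff_mul, Finset.Nat.sum_antidiagonal_eq_sum_range_succ_mk, Finset.sum_range_succ,
        Finset.sum_range_one, Nat.sub_zero, Nat.sub_self, i0, i1, h0]
      push_cast; ring
    · rw [Polynomial.coeff_mul, Finset.Nat.sum_antidiagonal_eq_sum_range_succ_mk, Finset.sum_range_succ, Finset.sum_range_succ,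
        Finset.sum_range_one, Nat.sub_zero, Nat.sub_self, show 2 - 1 = 1 from rfl, i0, i1, i2, h0, Nat.choose_succ_succ, Nat.choose_one_right]
      push_cast; ring

/-- `(P_c ∘ q)` as a sum of powers. [cite: JansevanRensburgWhittington2013, §3.2 Theorem 8 (arXiv v4 p. 11)] -/
theorem Pz_comp_eq (c : ℕ) (q : Polynomial ℤ) :
    (Pz N c).comp q = ∑ n ∈ Finset.range (2 * c + 2), Polynomial.C (N c n : ℤ) * q ^ n := by
  rw [Pz, Polynomial.sum_comp]
  refine Finset.sum_congr rfl fun n _ => ?_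
  rw [Polynomial.mul_comp, Polynomial.C_comp, Polynomial.X_pow_comp]

/-- `[X⁰](P_c ∘ q) = P_c(1)` for `q(0) = 1`. [cite: JansevanRensburgWhittington2013, §3.2 Theorem 8 (arXiv v4 p. 11)] -/
theorem coeff_Pz_comp_zero (c : ℕ) (q : Polynomial ℤ) (h0 : q.coeff 0 = 1) : ((Pz N c).comp q).coeff 0 = pS N c := by
  rw [Pz_comp_eq, Polynomial.finsetSum_coeff, pS]
  refine Finset.sum_congr rfl fun n _ => ?_
  rw [Polynomial.coeff_C_mul, (coeff_pow_low q h0 n).1, mul_one]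

/-- `[X¹](P_c ∘ q) = P_c'(1) q₁` for `q(0) = 1`. [cite: JansevanRensburgWhittington2013, §3.2 Theorem 8 (arXiv v4 p. 11)] -/
theorem coeff_Pz_comp_one (c : ℕ) (q : Polynomial ℤ) (h0 : q.coeff 0 = 1) : ((Pz N c).comp q).coeff 1 = pD N c * q.coeff 1 := by
  rw [Pz_comp_eq, Polynomial.finsetSum_coeff, pD, Finset.sum_mul]
  refine Finset.sum_congr rfl fun n _ => ?_
  rw [Polynomial.coeff_C_mul, (coeff_pow_low q h0 n).2.1]
  ring

/-- `[X²](P_c ∘ q) = P_c'(1) q₂ + ½P_c''(1) q₁²` for `q(0) = 1`. [cite: JansevanRensburgWhittington2013, §3.2 Theorem 8 (arXiv v4 p. 11)] -/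
theorem coeff_Pz_comp_two (c : ℕ) (q : Polynomial ℤ) (h0 : q.coeff 0 = 1) :
    ((Pz N c).comp q).coeff 2 = pD N c * q.coeff 2 + pH N c * q.coeff 1 ^ 2 := by
  rw [Pz_comp_eq, Polynomial.finsetSum_coeff, pD, pH, Finset.sum_mul, Finset.sum_mul, ← Finset.sum_add_distrib]
  refine Finset.sum_congr rfl fun n _ => ?_
  rw [Polynomial.coeff_C_mul, (coeff_pow_low q h0 n).2.2]
  ring

/-- The low coefficients of `A_1`: `1, −pS₁`. [cite: JansevanRensburgWhittington2013, §3.2 Theorem 8 (arXiv v4 p. 11)] -/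
theorem coeff_A_one : (A N 1).coeff 0 = 1 ∧ (A N 1).coeff 1 = -pS N 1 := by
  rw [A_one]
  refine ⟨by simp, ?_⟩
  rw [Polynomial.coeff_sub, Polynomial.coeff_one, Polynomial.coeff_X_mul, Polynomial.coeff_C_zero, pS]
  simp

/-- `1 − A_2 = X (P_1∘A_1 + X · P_2∘A_1)`. [cite: JansevanRensburgWhittington2013, §3.2 Theorem 8 (arXiv v4 p. 11)] -/
theorem one_sub_A_two : 1 - A N 2 = Polynomial.X * ((Pz N 1).comp (A N 1) + Polynomial.X * (Pz N 2).comp (A N 1)) := by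
  show 1 - (1 - ∑ j ∈ Finset.range (1 + 1), Polynomial.X ^ (j + 1) * (Pz N (j + 1)).comp (A N 1)) = _
  rw [sub_sub_cancel, Finset.sum_range_succ, Finset.sum_range_one]
  ring

/-- The low coefficients of `A_2`: `1, −pS₁, pD₁ pS₁ − pS₂`. [cite: JansevanRensburgWhittington2013, §3.2 Theorem 8 (arXiv v4 p. 11)] -/
theorem coeff_A_two : (A N 2).coeff 0 = 1 ∧ (A N 2).coeff 1 = -pS N 1 ∧ (A N 2).coeff 2 = pD N 1 * pS N 1 - pS N 2 := by
  have h : A N 2 = 1 - Polynomial.X * ((Pz N 1).comp (A N 1) + Polynomial.X * (Pz N 2).comp (A N 1)) := by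
    rw [← one_sub_A_two, sub_sub_cancel]
  obtain ⟨a0, a1⟩ := coeff_A_one N
  refine ⟨?_, ?_, ?_⟩
  · rw [h]; simp
  · rw [h, Polynomial.coeff_sub, Polynomial.coeff_one, Polynomial.coeff_X_mul, Polynomial.coeff_add, Polynomial.coeff_X_mul_zero,
      coeff_Pz_comp_zero N 1 _ a0]
    simp
  · rw [h, Polynomial.coeff_sub, Polynomial.coeff_one, show (2 : ℕ) = 1 + 1 from rfl, Polynomial.coeff_X_mul, Polynomial.coeff_add,
      Polynomial.coeff_X_mul, coeff_Pz_comp_one N 1 _ a0, coeff_Pz_comp_zero N 2 _ a0, a1]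
    simp; ring

/-- `1 − A_3 = X (P_1∘A_2 + X · P_2∘A_2 + X² · P_3∘A_2)`. [cite: JansevanRensburgWhittington2013, §3.2 Theorem 8 (arXiv v4 p. 11)] -/
theorem one_sub_A_three : 1 - A N 3 = Polynomial.X * ((Pz N 1).comp (A N 2) + Polynomial.X * (Pz N 2).comp (A N 2) +
    Polynomial.X ^ 2 * (Pz N 3).comp (A N 2)) := by
  show 1 - (1 - ∑ j ∈ Finset.range (2 + 1), Polynomial.X ^ (j + 1) * (Pz N (j + 1)).comp (A N 2)) = _
  rw [sub_sub_cancel, Finset.sum_range_succ, Finset.sum_range_succ, Finset.sum_range_one]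
  ring

/-- ★ **The third inverse coefficient** in terms of the moments of the cost data:
`e_3 = pD₁(pD₁ pS₁ − pS₂) + pH₁ pS₁² − pD₂ pS₁ + pS₃ + 2 pS₁ (pS₂ − pD₁ pS₁) + pS₁³`. [cite: JansevanRensburgWhittington2013, §3.2 Theorem 8 (arXiv v4 p. 11)] -/
theorem e_three : e N 3 = pD N 1 * (pD N 1 * pS N 1 - pS N 2) + pH N 1 * pS N 1 ^ 2 - pD N 2 * pS N 1 + pS N 3
    + 2 * pS N 1 * (pS N 2 - pD N 1 * pS N 1) + pS N 1 ^ 3 := by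
  obtain ⟨a0, a1, a2⟩ := coeff_A_two N
  set q1 := (Pz N 1).comp (A N 2) with hq1
  set q2 := (Pz N 2).comp (A N 2) with hq2
  set q3 := (Pz N 3).comp (A N 2) with hq3
  set r := q1 + Polynomial.X * q2 + Polynomial.X ^ 2 * q3 with hr
  have hr0 : r.coeff 0 = pS N 1 := by
    rw [hr, Polynomial.coeff_add, Polynomial.coeff_add, Polynomial.coeff_X_mul_zero, hq1, coeff_Pz_comp_zero N 1 _ a0]
    simp
  have hr1 : r.coeff 1 = -(pD N 1 * pS N 1) + pS N 2 := by
    rw [hr, Polynomial.coeff_add, Polynomial.coeff_add, Polynomial.coeff_X_mul, hq1, hq2, coeff_Pz_comp_one N 1 _ a0,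
      coeff_Pz_comp_zero N 2 _ a0, a1, show (1 : ℕ) = 0 + 1 from rfl]
    simp [Polynomial.coeff_X_pow_mul']
  have hr2 : r.coeff 2 = pD N 1 * (pD N 1 * pS N 1 - pS N 2) + pH N 1 * pS N 1 ^ 2 - pD N 2 * pS N 1 + pS N 3 := by
    rw [hr, Polynomial.coeff_add, Polynomial.coeff_add, show (2 : ℕ) = 1 + 1 from rfl, Polynomial.coeff_X_mul,
      hq1, hq2, hq3, coeff_Pz_comp_one N 2 _ a0, a1]
    rw [show (1 + 1 : ℕ) = 2 from rfl, coeff_Pz_comp_two N 1 _ a0, a1, a2, Polynomial.coeff_X_pow_mul', if_pos le_rfl, Nat.sub_self,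
      coeff_Pz_comp_zero N 3 _ a0]
    ring
  have hE : E N 3 = 1 + Polynomial.X * r + (Polynomial.X * r) ^ 2 + (Polynomial.X * r) ^ 3 := by
    show ∑ j ∈ Finset.range (3 + 1), (1 - A N 3) ^ j = _
    rw [one_sub_A_three, ← hq1, ← hq2, ← hq3, ← hr]
    simp [Finset.sum_range_succ]
  show (E N 3).coeff 3 = _
  rw [hE]
  have h1 : (Polynomial.X * r).coeff 3 = r.coeff 2 := by
    rw [show (3 : ℕ) = 2 + 1 from rfl, Polynomial.coeff_X_mul]
  have h2 : ((Polynomial.X * r) ^ 2).coeff 3 = 2 * r.coeff 0 * r.coeff 1 := by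
    rw [mul_pow, show (3 : ℕ) = 1 + 2 from rfl, Polynomial.coeff_X_pow_mul, pow_two, Polynomial.coeff_mul,
      Finset.Nat.sum_antidiagonal_eq_sum_range_succ_mk, Finset.sum_range_succ, Finset.sum_range_one]
    simp; ring
  have h3 : ((Polynomial.X * r) ^ 3).coeff 3 = r.coeff 0 ^ 3 := by
    rw [mul_pow, show (3 : ℕ) = 0 + 3 from rfl, Polynomial.coeff_X_pow_mul, pow_succ, pow_two, Polynomial.mul_coeff_zero,
      Polynomial.mul_coeff_zero]
    ring
  rw [Polynomial.coeff_add, Polynomial.coeff_add, Polynomial.coeff_add, Polynomial.coeff_one, if_neg (by norm_num), h1, h2, h3,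
    hr0, hr1, hr2]
  ring

end CostSeries

/-! ### The cost-three irreducible bridges of `ℤ^{d+1}`: four steps `+e₀, v₁, v₂, v₃`, transverse, no immediate reversal -/

/-- The reversed transverse step index. [cite: MadrasSlade1993, Definition 1.2.4] -/
def revIdx {d : ℕ} (a : Fin d × Bool) : Fin d × Bool := (a.1, !a.2)

/-- `v + w ≠ 0` unless `w` is the reversal of `v`. [cite: MadrasSlade1993, Definition 1.2.4] -/
theorem twoStepV_add_ne_zero (d : ℕ) {a b : Fin d × Bool} (h : b ≠ revIdx a) : twoStepV d a + twoStepV d b ≠ 0 :=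
  fun h0 => h (twoStepV_add_eq_zero d h0)

/-- Three transverse unit steps never sum to zero (parity of the coordinate sum). [cite: MadrasSlade1993, Definition 1.2.4] -/
theorem twoStepV_add_add_ne_zero (d : ℕ) (a b c : Fin d × Bool) : twoStepV d a + twoStepV d b + twoStepV d c ≠ 0 := by
  rcases a with ⟨ja, ba⟩; rcases b with ⟨jb, bb⟩; rcases c with ⟨jc, bc⟩
  intro h
  have hs := congrArg (fun x : Site (d + 1) => ∑ i, x i) h
  simp only [Pi.add_apply, Finset.sum_add_distrib, Pi.zero_apply, Finset.sum_const_zero, twoStepV, Finset.sum_pi_single',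
    Finset.mem_univ, if_true] at hs
  cases ba <;> cases bb <;> cases bc <;> simp at hs

/-- The index set: triples of transverse steps with no immediate reversal. [cite: MadrasSlade1993, §4.2, eq. (4.2.20)–(4.2.22) (p. 94, 2013 reprint)] -/
def fourStepIndex (d : ℕ) : Finset ((Fin d × Bool) × (Fin d × Bool) × (Fin d × Bool)) :=
  Finset.univ.filter fun s => s.2.1 ≠ revIdx s.1 ∧ s.2.2 ≠ revIdx s.2.1

/-- `#fourStepIndex = 2d(2d−1)²`. [cite: MadrasSlade1993, §4.2, eq. (4.2.20)–(4.2.22) (p. 94, 2013 reprint)] -/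
theorem card_fourStepIndex (d : ℕ) : (fourStepIndex d).card = 2 * d * (2 * d - 1) ^ 2 := by
  classical
  have hA : Fintype.card (Fin d × Bool) = 2 * d := by rw [Fintype.card_prod, Fintype.card_fin, Fintype.card_bool, mul_comm]
  -- the fibre over the first step `a`: pairs `(b, c)` with `b ≠ rev a`, `c ≠ rev b`
  have hne : ∀ x : Fin d × Bool, (Finset.univ.filter fun b : Fin d × Bool => b ≠ x).card = 2 * d - 1 := by
    intro x
    rw [Finset.filter_ne' Finset.univ x, Finset.card_erase_of_mem (Finset.mem_univ x), Finset.card_univ, hA]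
  have hfib : ∀ a : Fin d × Bool,
      (Finset.univ.filter fun p : (Fin d × Bool) × (Fin d × Bool) => p.1 ≠ revIdx a ∧ p.2 ≠ revIdx p.1).card = (2 * d - 1) ^ 2 := by
    intro a
    have heq : (Finset.univ.filter fun p : (Fin d × Bool) × (Fin d × Bool) => p.1 ≠ revIdx a ∧ p.2 ≠ revIdx p.1) =
        (Finset.univ.filter fun b : Fin d × Bool => b ≠ revIdx a).biUnion
          fun b => (Finset.univ.filter fun c : Fin d × Bool => c ≠ revIdx b).image fun c => (b, c) := by
      ext ⟨b, c⟩
      simp only [Finset.mem_filter, Finset.mem_univ, true_and, Finset.mem_biUnion, Finset.mem_image, Prod.mk.injEq]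
      constructor
      · rintro ⟨h1, h2⟩; exact ⟨b, h1, c, h2, rfl, rfl⟩
      · rintro ⟨b', h1, c', h2, rfl, rfl⟩; exact ⟨h1, h2⟩
    rw [heq, Finset.card_biUnion]
    · have : ∀ b ∈ (Finset.univ.filter fun b : Fin d × Bool => b ≠ revIdx a),
          ((Finset.univ.filter fun c : Fin d × Bool => c ≠ revIdx b).image fun c => (b, c)).card = 2 * d - 1 := by
        intro b _
        rw [Finset.card_image_of_injective _ (fun c c' h => (Prod.mk.inj h).2), hne]
      rw [Finset.sum_congr rfl this, Finset.sum_const, hne, smul_eq_mul, pow_two]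
    · intro b _ b' _ hbb'
      simp only [Function.onFun]
      rw [Finset.disjoint_left]
      intro x hx hx'
      obtain ⟨c, -, rfl⟩ := Finset.mem_image.1 hx
      obtain ⟨c', -, h⟩ := Finset.mem_image.1 hx'
      exact hbb' (Prod.mk.inj h).1.symm
  have heq : fourStepIndex d = (Finset.univ : Finset (Fin d × Bool)).biUnion fun a =>
      (Finset.univ.filter fun p : (Fin d × Bool) × (Fin d × Bool) => p.1 ≠ revIdx a ∧ p.2 ≠ revIdx p.1).image fun p => (a, p) := by
    ext ⟨a, b, c⟩
    simp only [fourStepIndex, Finset.mem_filter, Finset.mem_univ, true_and, Finset.mem_biUnion, Finset.mem_image, Prod.mk.injEq]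
    constructor
    · rintro ⟨h1, h2⟩; exact ⟨a, (b, c), ⟨h1, h2⟩, rfl, rfl⟩
    · rintro ⟨a', p, ⟨h1, h2⟩, rfl, rfl⟩; exact ⟨h1, h2⟩
  rw [heq, Finset.card_biUnion]
  · have : ∀ a ∈ (Finset.univ : Finset (Fin d × Bool)),
        ((Finset.univ.filter fun p : (Fin d × Bool) × (Fin d × Bool) => p.1 ≠ revIdx a ∧ p.2 ≠ revIdx p.1).image fun p => (a, p)).card
          = (2 * d - 1) ^ 2 := by
      intro a _
      rw [Finset.card_image_of_injective _ (fun p p' h => (Prod.mk.inj h).2), hfib]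
    rw [Finset.sum_congr rfl this, Finset.sum_const, Finset.card_univ, hA, smul_eq_mul]
  · intro a _ a' _ haa'
    simp only [Function.onFun]
    rw [Finset.disjoint_left]
    intro x hx hx'
    obtain ⟨p, -, rfl⟩ := Finset.mem_image.1 hx
    obtain ⟨p', -, h⟩ := Finset.mem_image.1 hx'
    exact haa' (Prod.mk.inj h).1.symm

/-- The four-step walk `(0, e₀, e₀+v₁, e₀+v₁+v₂, e₀+v₁+v₂+v₃)`. [cite: MadrasSlade1993, Definition 1.2.4] -/
def fourStep (d : ℕ) (s : (Fin d × Bool) × (Fin d × Bool) × (Fin d × Bool)) : ℕ → Site (d + 1) := fun i =>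
  if i = 0 then 0 else if i = 1 then Pi.single 0 1 else if i = 2 then Pi.single 0 1 + twoStepV d s.1
  else if i = 3 then Pi.single 0 1 + twoStepV d s.1 + twoStepV d s.2.1
  else Pi.single 0 1 + twoStepV d s.1 + twoStepV d s.2.1 + twoStepV d s.2.2

/-- Value at `0`. [cite: MadrasSlade1993, Definition 1.2.4] -/
@[simp] theorem fourStep_zero (d : ℕ) (s) : fourStep d s 0 = 0 := by simp [fourStep]

/-- Value at `1`. [cite: MadrasSlade1993, Definition 1.2.4] -/
@[simp] theorem fourStep_one (d : ℕ) (s) : fourStep d s 1 = Pi.single 0 1 := by simp [fourStep]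

/-- Value at `2`. [cite: MadrasSlade1993, Definition 1.2.4] -/
@[simp] theorem fourStep_two (d : ℕ) (s) : fourStep d s 2 = Pi.single 0 1 + twoStepV d s.1 := by simp [fourStep]

/-- Value at `3`. [cite: MadrasSlade1993, Definition 1.2.4] -/
@[simp] theorem fourStep_three (d : ℕ) (s) : fourStep d s 3 = Pi.single 0 1 + twoStepV d s.1 + twoStepV d s.2.1 := by simp [fourStep]

/-- Value at `i ≥ 4`. [cite: MadrasSlade1993, Definition 1.2.4] -/
theorem fourStep_of_four_le (d : ℕ) (s) {i : ℕ} (hi : 4 ≤ i) :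
    fourStep d s i = Pi.single 0 1 + twoStepV d s.1 + twoStepV d s.2.1 + twoStepV d s.2.2 := by
  have h0 : i ≠ 0 := by omega
  have h1 : i ≠ 1 := by omega
  have h2 : i ≠ 2 := by omega
  have h3 : i ≠ 3 := by omega
  simp [fourStep, h0, h1, h2, h3]

/-- Heights along `fourStep`: `0, 1, 1, 1, 1, …`. [cite: MadrasSlade1993, Definition 1.2.4] -/
theorem fourStep_apply_zero (d : ℕ) (s) (i : ℕ) : fourStep d s i 0 = if i = 0 then 0 else 1 := by
  rcases Nat.lt_or_ge i 4 with hi | hi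
  · interval_cases i <;> simp
  · rw [fourStep_of_four_le d s hi, if_neg (by omega)]
    simp

/-- `fourStep s`, `s ∈ fourStepIndex`, is a four-step self-avoiding walk. [cite: MadrasSlade1993, Definition 1.2.4] -/
theorem fourStep_mem_saws (d : ℕ) {s} (hs : s ∈ fourStepIndex d) : fourStep d s ∈ saws (d + 1) 4 := by
  obtain ⟨h12, h23⟩ := (Finset.mem_filter.1 hs).2
  refine mem_saws.2 ⟨fourStep_zero d s, fun i hi => ?_, fun i hi => ?_, ?_⟩
  · rw [fourStep_of_four_le d s hi, fourStep_of_four_le d s le_rfl]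
  · interval_cases i
    · rw [fourStep_zero, zero_add, fourStep_one, zdGraph_adj_iff]
      exact ⟨0, Or.inl (by simp)⟩
    · rw [fourStep_one, fourStep_two]
      exact adj_add_twoStepV d _ _
    · rw [fourStep_two, fourStep_three]
      exact adj_add_twoStepV d _ _
    · rw [fourStep_three, fourStep_of_four_le d s le_rfl]
      exact adj_add_twoStepV d _ _
  · have hne : ∀ i j : ℕ, i ≤ 4 → j ≤ 4 → i < j → fourStep d s i ≠ fourStep d s j := by
      intro i j hi hj hij h
      have hh := congrFun h 0
      rw [fourStep_apply_zero, fourStep_apply_zero] at hh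
      have hi0 : i ≠ 0 := by rintro rfl; simp [show j ≠ 0 by omega] at hh
      have hij' : (i = 1 ∧ j = 2) ∨ (i = 1 ∧ j = 3) ∨ (i = 1 ∧ j = 4) ∨ (i = 2 ∧ j = 3) ∨ (i = 2 ∧ j = 4) ∨ (i = 3 ∧ j = 4) := by
        omega
      rcases hij' with ⟨rfl, rfl⟩ | ⟨rfl, rfl⟩ | ⟨rfl, rfl⟩ | ⟨rfl, rfl⟩ | ⟨rfl, rfl⟩ | ⟨rfl, rfl⟩
      · rw [fourStep_one, fourStep_two] at h
        exact twoStepV_ne_zero d s.1 (by simpa using h.symm)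
      · rw [fourStep_one, fourStep_three, add_assoc] at h
        exact twoStepV_add_ne_zero d h12 (by simpa using h.symm)
      · rw [fourStep_one, fourStep_of_four_le d s le_rfl, add_assoc, add_assoc] at h
        have h' : twoStepV d s.1 + (twoStepV d s.2.1 + twoStepV d s.2.2) = 0 := by simpa using h.symm
        exact twoStepV_add_add_ne_zero d s.1 s.2.1 s.2.2 (by rw [add_assoc]; exact h')
      · rw [fourStep_two, fourStep_three] at h
        exact twoStepV_ne_zero d s.2.1 (by simpa using h.symm)
      · rw [fourStep_two, fourStep_of_four_le d s le_rfl, add_assoc (Pi.single 0 1 + twoStepV d s.1)] at h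
        exact twoStepV_add_ne_zero d h23 (by simpa using h.symm)
      · rw [fourStep_three, fourStep_of_four_le d s le_rfl] at h
        exact twoStepV_ne_zero d s.2.2 (by simpa using h.symm)
    intro i hi j hj h
    simp only [Set.mem_setOf_eq] at hi hj
    rcases lt_trichotomy i j with hij | rfl | hij
    · exact absurd h (hne i j hi hj hij)
    · rfl
    · exact absurd h.symm (hne j i hj hi hij)

/-- `fourStep s` is an irreducible bridge of cost three. [cite: DuminilCopinHammond2013, §2.2] -/
theorem fourStep_mem_filter (d : ℕ) {s} (hs : s ∈ fourStepIndex d) :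
    fourStep d s ∈ (irreducibleBridges (d + 1) 4).filter fun ω => costZd d 4 ω = 3 := by
  have hb : IsBridge 4 (fourStep d s) := by
    intro i h1 h2
    rw [fourStep_apply_zero, fourStep_apply_zero, fourStep_apply_zero, if_pos rfl, if_neg (by omega), if_neg (by omega)]
    exact ⟨zero_lt_one, le_rfl⟩
  refine Finset.mem_filter.2 ⟨mem_irreducibleBridges.2 ⟨mem_bridges.2 ⟨fourStep_mem_saws d hs, hb⟩,
    ⟨by norm_num, hb, fun k hk1 hk2 hren => ?_⟩⟩, ?_⟩
  · have h := (hren.2.2 1 le_rfl (by omega)).1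
    simp only [add_zero, fourStep_apply_zero] at h
    have hk0 : k ≠ 0 := by omega
    have hk1' : k + 1 ≠ 0 := by omega
    rw [if_neg hk0, if_neg hk1'] at h
    exact lt_irrefl _ h
  · simp [costZd, fourStep_apply_zero]

/-- Every cost-three irreducible bridge of length four is a `fourStep`. [cite: MadrasSlade1993, Definition 1.2.4] -/
theorem eq_fourStep_of_mem (d : ℕ) {ω : ℕ → Site (d + 1)}
    (hω : ω ∈ (irreducibleBridges (d + 1) 4).filter fun ω => costZd d 4 ω = 3) : ∃ s ∈ fourStepIndex d, ω = fourStep d s := by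
  obtain ⟨hirr, hcost⟩ := Finset.mem_filter.1 hω
  obtain ⟨hbr, -⟩ := mem_irreducibleBridges.1 hirr
  obtain ⟨hωs, hb⟩ := mem_bridges.1 hbr
  obtain ⟨h0, hend, hadj, hinj⟩ := mem_saws.1 hωs
  have hω1 : ω 1 = Pi.single 0 1 := apply_one_eq_e0_of_mem_bridges d (by norm_num) hbr
  have h4eq : ω 4 0 = 1 := by
    have hc : costZd d 4 ω = 3 := hcost
    simp only [costZd] at hc
    have := (span_le_and_cost_bound_zd hirr).1
    have h40 : 0 < ω 4 0 := by have := (hb 4 (by norm_num) le_rfl).1; rwa [h0] at this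
    omega
  have h1eq : ω 1 0 = 1 := by rw [hω1]; simp
  have h2eq : ω 2 0 = 1 := by
    have h := hb 2 (by norm_num) (by norm_num)
    rw [h0, h4eq] at h
    simp only [Pi.zero_apply] at h
    omega
  have h3eq : ω 3 0 = 1 := by
    have h := hb 3 (by norm_num) (by norm_num)
    rw [h0, h4eq] at h
    simp only [Pi.zero_apply] at h
    omega
  obtain ⟨a, ha⟩ := exists_twoStepV_of_adj d (hadj 1 (by norm_num)) (by rw [h2eq, h1eq])
  obtain ⟨b, hb'⟩ := exists_twoStepV_of_adj d (hadj 2 (by norm_num)) (by rw [h3eq, h2eq])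
  obtain ⟨c, hc'⟩ := exists_twoStepV_of_adj d (hadj 3 (by norm_num)) (by rw [h4eq, h3eq])
  have hab : b ≠ revIdx a := by
    intro hba
    have h13 : ω 3 = ω 1 := by
      rw [hb', ha, hba, revIdx, twoStepV_not, add_assoc, add_neg_cancel, add_zero]
    have := hinj (show (3 : ℕ) ∈ {i | i ≤ 4} by simp) (show (1 : ℕ) ∈ {i | i ≤ 4} by simp) h13
    omega
  have hbc : c ≠ revIdx b := by
    intro hcb
    have h24 : ω 4 = ω 2 := by
      rw [hc', hb', hcb, revIdx, twoStepV_not, add_assoc, add_neg_cancel, add_zero]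
    have := hinj (show (4 : ℕ) ∈ {i | i ≤ 4} by simp) (show (2 : ℕ) ∈ {i | i ≤ 4} by simp) h24
    omega
  refine ⟨(a, b, c), Finset.mem_filter.2 ⟨Finset.mem_univ _, hab, hbc⟩, funext fun i => ?_⟩
  rcases Nat.lt_or_ge i 4 with hi4 | hi4
  · interval_cases i
    · rw [h0, fourStep_zero]
    · rw [hω1, fourStep_one]
    · rw [ha, hω1, fourStep_two]
    · rw [hb', ha, hω1, fourStep_three]
  · rw [hend i hi4, hc', hb', ha, hω1, fourStep_of_four_le d _ hi4]

/-- `fourStep` is injective. [cite: MadrasSlade1993, Definition 1.2.4] -/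
theorem fourStep_injective (d : ℕ) : Function.Injective (fourStep d) := by
  rintro ⟨a, b, c⟩ ⟨a', b', c'⟩ h
  have h2 := congrFun h 2
  rw [fourStep_two, fourStep_two, add_right_inj] at h2
  have ha : a = a' := twoStepV_injective d h2
  have h3 := congrFun h 3
  rw [fourStep_three, fourStep_three, ha, add_right_inj] at h3
  have hb : b = b' := twoStepV_injective d h3
  have h4 := congrFun h 4
  rw [fourStep_of_four_le d _ le_rfl, fourStep_of_four_le d _ le_rfl, ha, hb, add_right_inj] at h4
  have hc : c = c' := twoStepV_injective d h4
  rw [ha, hb, hc]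

/-- ★ The cost-three irreducible bridges of length four are exactly the `fourStep`s.
[cite: MadrasSlade1993, §4.2, eq. (4.2.20)–(4.2.22) (p. 94, 2013 reprint)] -/
theorem filter_costZd_three_four_eq_image (d : ℕ) [DecidableEq (ℕ → Site (d + 1))] :
    ((irreducibleBridges (d + 1) 4).filter fun ω => costZd d 4 ω = 3) = (fourStepIndex d).image (fourStep d) := by
  ext ω
  constructor
  · intro h
    obtain ⟨s, hs, rfl⟩ := eq_fourStep_of_mem d h
    exact Finset.mem_image_of_mem _ hs
  · intro h
    obtain ⟨s, hs, rfl⟩ := Finset.mem_image.1 h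
    exact fourStep_mem_filter d hs

/-- ★ **`N_{3,4} = 2d(2d−1)²`** on `ℤ^{d+1}`. [cite: MadrasSlade1993, §4.2, eq. (4.2.20)–(4.2.22) (p. 94, 2013 reprint)] -/
theorem costCoeffZd_three_four (d : ℕ) : costCoeffZd d 3 4 = 2 * d * (2 * d - 1) ^ 2 := by
  classical
  rw [costCoeffZd, filter_costZd_three_four_eq_image, Finset.card_image_of_injective _ (fourStep_injective d),
    card_fourStepIndex]

/-- **No cost-three irreducible bridge has length five**: heights `0, 1, h₂, h₃, h₄, 2` (`hᵢ ∈ {1, 2}`) force a renewal time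
(`(h₂,h₃,h₄) = (1,1,1), (1,1,2), (1,2,2), (2,2,2)`) or a revisited site (`(2,1,·)`: `ω₃ = ω₁`; `(1,2,1)`: `ω₄ = ω₂`; `(2,2,1)`: `ω₅ = ω₃`).
[cite: DuminilCopinHammond2013, §2.2] -/
theorem costCoeffZd_three_five (d : ℕ) : costCoeffZd d 3 5 = 0 := by
  rw [costCoeffZd, Finset.card_eq_zero, Finset.filter_eq_empty_iff]
  intro ω hirr hcost
  obtain ⟨hbr, hI⟩ := mem_irreducibleBridges.1 hirr
  obtain ⟨hωs, hb⟩ := mem_bridges.1 hbr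
  obtain ⟨h0, -, hadj, hinj⟩ := mem_saws.1 hωs
  have hω1 : ω 1 = Pi.single 0 1 := apply_one_eq_e0_of_mem_bridges d (by norm_num) hbr
  have h1 : ω 1 0 = 1 := by rw [hω1]; simp
  have h5 : ω 5 0 = 2 := by
    simp only [costZd] at hcost
    have := (span_le_and_cost_bound_zd hirr).1
    have h50 : 0 < ω 5 0 := by have := (hb 5 (by norm_num) le_rfl).1; rwa [h0] at this
    omega
  have hb2 := hb 2 (by norm_num) (by norm_num)
  have hb3 := hb 3 (by norm_num) (by norm_num)
  have hb4 := hb 4 (by norm_num) (by norm_num)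
  rw [h0, h5] at hb2 hb3 hb4
  simp only [Pi.zero_apply] at hb2 hb3 hb4
  have hd12 : |ω 2 0 - ω 1 0| ≤ 1 := abs_sub_le_one_of_adj (hadj 1 (by norm_num)) 0
  have hd23 : |ω 3 0 - ω 2 0| ≤ 1 := abs_sub_le_one_of_adj (hadj 2 (by norm_num)) 0
  have hd34 : |ω 4 0 - ω 3 0| ≤ 1 := abs_sub_le_one_of_adj (hadj 3 (by norm_num)) 0
  have hnoren := hI.2.2
  have hren : ∀ k, 1 ≤ k → k ≤ 4 → (∀ i, 1 ≤ i → i ≤ k → 0 < ω i 0 ∧ ω i 0 ≤ ω k 0) →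
      (∀ i, 1 ≤ i → i ≤ 5 - k → ω k 0 < ω (k + i) 0 ∧ ω (k + i) 0 ≤ ω 5 0) → False := by
    intro k hk1 hk4 hpre hsuf
    refine hnoren k hk1 (by omega) ⟨by omega, fun i hi1 hi2 => ?_, fun i hi1 hi2 => ?_⟩
    · rw [h0]; exact hpre i hi1 hi2
    · have := hsuf i hi1 hi2
      simp only [add_zero]
      rwa [show k + (5 - k) = 5 by omega]
  have hmem : ∀ i : ℕ, i ≤ 5 → i ∈ {j : ℕ | j ≤ 5} := fun i hi => hi
  have h2cases : ω 2 0 = 1 ∨ ω 2 0 = 2 := by omega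
  rcases h2cases with h2 | h2
  · have h3cases : ω 3 0 = 1 ∨ ω 3 0 = 2 := by omega
    rcases h3cases with h3 | h3
    · have h4cases : ω 4 0 = 1 ∨ ω 4 0 = 2 := by omega
      rcases h4cases with h4 | h4
      · -- (1,1,1): renewal at 4
        refine hren 4 (by norm_num) le_rfl (fun i hi1 hi2 => ?_) (fun i hi1 hi2 => ?_)
        · interval_cases i <;> simp [h1, h2, h3, h4]
        · obtain rfl : i = 1 := by omega
          simp [h4, h5]
      · -- (1,1,2): renewal at 3
        refine hren 3 (by norm_num) (by norm_num) (fun i hi1 hi2 => ?_) (fun i hi1 hi2 => ?_)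
        · interval_cases i <;> simp [h1, h2, h3]
        · interval_cases i <;> simp [h3, h4, h5]
    · have h4cases : ω 4 0 = 1 ∨ ω 4 0 = 2 := by omega
      rcases h4cases with h4 | h4
      · -- (1,2,1): `ω₄ = ω₂`
        have h23 : ω 3 = ω 2 + Pi.single 0 1 := eq_add_e0_of_adj d (hadj 2 (by norm_num)) (by rw [h3, h2]; norm_num)
        have h34 : ω 4 = ω 3 - Pi.single 0 1 := eq_sub_e0_of_adj d (hadj 3 (by norm_num)) (by rw [h4, h3]; norm_num)
        have h24 : ω 4 = ω 2 := by rw [h34, h23, add_sub_cancel_right]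
        have := hinj (hmem 4 (by norm_num)) (hmem 2 (by norm_num)) h24
        omega
      · -- (1,2,2): renewal at 2
        refine hren 2 (by norm_num) (by norm_num) (fun i hi1 hi2 => ?_) (fun i hi1 hi2 => ?_)
        · interval_cases i <;> simp [h1, h2]
        · interval_cases i <;> simp [h2, h3, h4, h5]
  · have h3cases : ω 3 0 = 1 ∨ ω 3 0 = 2 := by omega
    rcases h3cases with h3 | h3
    · -- (2,1,·): `ω₃ = ω₁`
      have h12 : ω 2 = ω 1 + Pi.single 0 1 := eq_add_e0_of_adj d (hadj 1 (by norm_num)) (by rw [h2, h1]; norm_num)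
      have h23 : ω 3 = ω 2 - Pi.single 0 1 := eq_sub_e0_of_adj d (hadj 2 (by norm_num)) (by rw [h3, h2]; norm_num)
      have h13 : ω 3 = ω 1 := by rw [h23, h12, add_sub_cancel_right]
      have := hinj (hmem 3 (by norm_num)) (hmem 1 (by norm_num)) h13
      omega
    · have h4cases : ω 4 0 = 1 ∨ ω 4 0 = 2 := by omega
      rcases h4cases with h4 | h4
      · -- (2,2,1): `ω₅ = ω₃`
        have h34 : ω 4 = ω 3 - Pi.single 0 1 := eq_sub_e0_of_adj d (hadj 3 (by norm_num)) (by rw [h4, h3]; norm_num)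
        have h45 : ω 5 = ω 4 + Pi.single 0 1 := eq_add_e0_of_adj d (hadj 4 (by norm_num)) (by rw [h5, h4]; norm_num)
        have h35 : ω 5 = ω 3 := by rw [h45, h34, sub_add_cancel]
        have := hinj (hmem 5 le_rfl) (hmem 3 (by norm_num)) h35
        omega
      · -- (2,2,2): renewal at 1
        refine hren 1 le_rfl (by norm_num) (fun i hi1 hi2 => ?_) (fun i hi1 hi2 => ?_)
        · obtain rfl : i = 1 := by omega
          simp [h1]
        · interval_cases i <;> simp [h1, h2, h3, h4, h5]

/-- `N_{3,3} = 0` (a three-step bridge ends at positive height, so its cost is at most two… precisely `3 − h₃ = 3` forces `h₃ = 0`).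
[cite: MadrasSlade1993, §4.2, eq. (4.2.20)–(4.2.22) (p. 94, 2013 reprint)] -/
theorem costCoeffZd_three_three (d : ℕ) : costCoeffZd d 3 3 = 0 := by
  rw [costCoeffZd, Finset.card_eq_zero, Finset.filter_eq_empty_iff]
  intro ω hirr hcost
  obtain ⟨hbr, -⟩ := mem_irreducibleBridges.1 hirr
  obtain ⟨hωs, hb⟩ := mem_bridges.1 hbr
  have h0 := (mem_saws.1 hωs).1
  have h30 : 0 < ω 3 0 := by have := (hb 3 (by norm_num) le_rfl).1; rwa [h0] at this
  simp only [costZd] at hcost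
  omega

/-- ★ **`N_{3,n}`** on `ℤ^{d+1}`: `2d(2d−1)²` at `n = 4`, zero otherwise. [cite: MadrasSlade1993, §4.2, eq. (4.2.20)–(4.2.22) (p. 94, 2013 reprint)] -/
theorem costCoeffZd_three (d n : ℕ) : costCoeffZd d 3 n = if n = 4 then 2 * d * (2 * d - 1) ^ 2 else 0 := by
  by_cases hn : n = 4
  · subst hn; rw [if_pos rfl, costCoeffZd_three_four]
  rw [if_neg hn]
  rcases Nat.lt_or_ge n 6 with h | h
  · interval_cases n
    · exact costCoeffZd_eq_zero_of_lt' (by norm_num)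
    · exact costCoeffZd_eq_zero_of_lt' (by norm_num)
    · exact costCoeffZd_eq_zero_of_lt' (by norm_num)
    · exact costCoeffZd_three_three d
    · exact absurd rfl hn
    · exact costCoeffZd_three_five d
  · exact costCoeffZd_eq_zero_of_lt (by omega)

/-! ### The moments of the cost data of `ℤ^{d+1}` and `c^{(d)}_3` -/

/-- `pS₁ = 2d`. [cite: JansevanRensburgWhittington2013, §3.2 Theorem 8 (arXiv v4 p. 11)] -/
theorem pS_one (d : ℕ) : CostSeries.pS (costCoeffZd d) 1 = 2 * d := by
  rw [CostSeries.pS, show 2 * 1 + 2 = 4 from rfl]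
  simp only [ Finset.sum_range_succ, Finset.sum_range_zero, costCoeffZd_one_two,
    costCoeffZd_one_of_ne_two d (show (0:ℕ) ≠ 2 by norm_num), costCoeffZd_one_of_ne_two d (show (1:ℕ) ≠ 2 by norm_num),
    costCoeffZd_one_of_ne_two d (show (3:ℕ) ≠ 2 by norm_num)]
  push_cast; ring

/-- `pD₁ = 4d`. [cite: JansevanRensburgWhittington2013, §3.2 Theorem 8 (arXiv v4 p. 11)] -/
theorem pD_one (d : ℕ) : CostSeries.pD (costCoeffZd d) 1 = 4 * d := by
  rw [CostSeries.pD, show 2 * 1 + 2 = 4 from rfl]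
  simp only [ Finset.sum_range_succ, Finset.sum_range_zero, costCoeffZd_one_two,
    costCoeffZd_one_of_ne_two d (show (0:ℕ) ≠ 2 by norm_num), costCoeffZd_one_of_ne_two d (show (1:ℕ) ≠ 2 by norm_num),
    costCoeffZd_one_of_ne_two d (show (3:ℕ) ≠ 2 by norm_num)]
  push_cast; ring

/-- `pH₁ = 2d`. [cite: JansevanRensburgWhittington2013, §3.2 Theorem 8 (arXiv v4 p. 11)] -/
theorem pH_one (d : ℕ) : CostSeries.pH (costCoeffZd d) 1 = 2 * d := by
  rw [CostSeries.pH, show 2 * 1 + 2 = 4 from rfl]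
  simp only [ Finset.sum_range_succ, Finset.sum_range_zero, costCoeffZd_one_two,
    costCoeffZd_one_of_ne_two d (show (0:ℕ) ≠ 2 by norm_num), costCoeffZd_one_of_ne_two d (show (1:ℕ) ≠ 2 by norm_num),
    costCoeffZd_one_of_ne_two d (show (3:ℕ) ≠ 2 by norm_num), Nat.choose]
  push_cast; ring

/-- `pS₂ = 2d(2d−1)`. [cite: JansevanRensburgWhittington2013, §3.2 Theorem 8 (arXiv v4 p. 11)] -/
theorem pS_two (d : ℕ) : CostSeries.pS (costCoeffZd d) 2 = 2 * d * (2 * d - 1) := by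
  rw [CostSeries.pS, show 2 * 2 + 2 = 6 from rfl]
  simp only [Finset.sum_range_succ, Finset.sum_range_zero, costCoeffZd_two]
  rcases Nat.eq_zero_or_pos d with rfl | hd
  · simp
  · obtain ⟨e, rfl⟩ : ∃ e, d = e + 1 := ⟨d - 1, by omega⟩
    simp only [show 2 * (e + 1) - 1 = 2 * e + 1 by omega]
    push_cast; ring

/-- `pD₂ = 3 · 2d(2d−1)`. [cite: JansevanRensburgWhittington2013, §3.2 Theorem 8 (arXiv v4 p. 11)] -/
theorem pD_two (d : ℕ) : CostSeries.pD (costCoeffZd d) 2 = 3 * (2 * d * (2 * d - 1)) := by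
  rw [CostSeries.pD, show 2 * 2 + 2 = 6 from rfl]
  simp only [Finset.sum_range_succ, Finset.sum_range_zero, costCoeffZd_two]
  rcases Nat.eq_zero_or_pos d with rfl | hd
  · simp
  · obtain ⟨e, rfl⟩ : ∃ e, d = e + 1 := ⟨d - 1, by omega⟩
    simp only [show 2 * (e + 1) - 1 = 2 * e + 1 by omega]
    push_cast; ring

/-- `pS₃ = 2d(2d−1)²`. [cite: JansevanRensburgWhittington2013, §3.2 Theorem 8 (arXiv v4 p. 11)] -/
theorem pS_three (d : ℕ) : CostSeries.pS (costCoeffZd d) 3 = 2 * d * (2 * d - 1) ^ 2 := by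
  rw [CostSeries.pS, show 2 * 3 + 2 = 8 from rfl]
  simp only [Finset.sum_range_succ, Finset.sum_range_zero, costCoeffZd_three]
  rcases Nat.eq_zero_or_pos d with rfl | hd
  · simp
  · obtain ⟨e, rfl⟩ : ∃ e, d = e + 1 := ⟨d - 1, by omega⟩
    simp only [show 2 * (e + 1) - 1 = 2 * e + 1 by omega]
    push_cast; ring

/-- ★★ **THE THIRD COEFFICIENT: `c^{(d)}_3 = 2d(2d+1)`** on `ℤ^{d+1}`. [cite: JansevanRensburgWhittington2013, §3.2 Theorem 8 (arXiv v4 p. 11)] -/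
theorem largeForceCoeffZd_at_three (d : ℕ) : largeForceCoeffZd d 3 = 2 * d * (2 * d + 1) := by
  show CostSeries.e (costCoeffZd d) 3 = _
  rw [CostSeries.e_three, pS_one, pD_one, pH_one, pS_two, pD_two, pS_three]
  ring

/-- `c_3 = 6` on `ℤ²` (agreeing with the certified value, here without certificates). [cite: JansevanRensburgWhittington2013, §3.2 Theorem 8 (arXiv v4 p. 11)] -/
theorem largeForceCoeff_three_eq_six : largeForceCoeff 3 = 6 := by
  rw [← largeForceCoeffZd_one 3, largeForceCoeffZd_at_three]; rfl

/-- ★★ **`e^{λ_B(y)} = y + 2d − 2d/y + 2d(2d+1)/y² + O(1/y³)` on `ℤ^{d+1}`, every dimension.**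
[cite: JansevanRensburgWhittington2013, §3.2 Theorem 8 (arXiv v4 p. 11)] -/
theorem exp_pulledBridgeFreeEnergy_third_order_zd (d : ℕ) :
    ∃ C y₁ : ℝ, 0 < y₁ ∧ ∀ y ≥ y₁,
      |Real.exp (pulledBridgeFreeEnergy (d + 1) y) - (y + 2 * d - 2 * d / y + 2 * d * (2 * d + 1) / y ^ 2)| ≤ C / y ^ 3 := by
  obtain ⟨C, y₁, hy₁, h⟩ := exp_pulledBridgeFreeEnergy_expansion_zd d 3
  refine ⟨C, y₁, hy₁, fun y hy => ?_⟩
  have hy0 : 0 < y := lt_of_lt_of_le hy₁ hy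
  have h1 := h y hy
  have hs : ∑ k ∈ Finset.range (3 + 1), y * ((largeForceCoeffZd d k : ℝ) * y⁻¹ ^ k) =
      y + 2 * d - 2 * d / y + 2 * d * (2 * d + 1) / y ^ 2 := by
    rw [Finset.sum_range_succ, Finset.sum_range_succ, Finset.sum_range_succ, Finset.sum_range_one, largeForceCoeffZd_zero,
      largeForceCoeffZd_at_one, largeForceCoeffZd_at_two, largeForceCoeffZd_at_three]
    push_cast
    field_simp
    ring
  rwa [hs] at h1

/-! ### Analyticity at `y = ∞` in every dimension -/

/-- The generating power series `g_d(t) := Σ_k c^{(d)}_k t^k` as a formal multilinear series on `ℝ`.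
[cite: JansevanRensburgWhittington2013, §3.2 Theorem 8 (arXiv v4 p. 11)] -/
def largeForceSeriesZd (d : ℕ) : FormalMultilinearSeries ℝ ℝ ℝ :=
  FormalMultilinearSeries.ofScalars ℝ (fun k => (largeForceCoeffZd d k : ℝ))

/-- The formal series has positive radius (geometric coefficient bound `|c^{(d)}_k| ≤ 3^{k+1}(16ρ(B+1))^k`, `B = 2κ_d`, `ρ = 2κ_d²`).
[cite: JansevanRensburgWhittington2013, §3.2 Theorem 8 (arXiv v4 p. 11)] -/
theorem largeForceSeriesZd_radius_pos (d : ℕ) : 0 < (largeForceSeriesZd d).radius := by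
  have hκ : 1 ≤ kappaZd d := by unfold kappaZd; exact_mod_cast one_le_count (d + 1) 1
  set B : ℝ := 2 * kappaZd d with hBdef
  set ρ : ℝ := 2 * kappaZd d ^ 2 with hρdef
  have hB : 0 ≤ B := by positivity
  have hρ : 0 < ρ := by positivity
  have hN : ∀ c, (∑ n ∈ Finset.range (2 * c + 2), (costCoeffZd d c n : ℝ)) ≤ B * ρ ^ c := sum_costCoeffZd_le d
  have hpos : (0 : ℝ) < 1 / (96 * ρ * (B + 1)) := by positivity
  set r : NNReal := (1 / (96 * ρ * (B + 1))).toNNReal with hr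
  have hr0' : 0 < r := by rw [hr]; exact Real.toNNReal_pos.2 hpos
  have hr0 : (0 : ENNReal) < r := ENNReal.coe_pos.2 hr0'
  refine lt_of_lt_of_le hr0 (FormalMultilinearSeries.le_radius_of_bound _ 3 fun k => ?_)
  have hco : (r : ℝ) = 1 / (96 * ρ * (B + 1)) := by rw [hr]; exact Real.coe_toNNReal _ hpos.le
  rw [largeForceSeriesZd, FormalMultilinearSeries.ofScalars_norm, hco, Real.norm_eq_abs]
  have h1 := CostSeries.abs_e_le (costCoeffZd d) hB hρ hN k
  have hc : ((largeForceCoeffZd d k : ℤ) : ℝ) = ((CostSeries.e (costCoeffZd d) k : ℤ) : ℝ) := rfl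
  rw [hc]
  have hq : 3 * (16 * ρ * (B + 1) * (1 / (96 * ρ * (B + 1)))) = 1 / 2 := by field_simp; ring
  calc |((CostSeries.e (costCoeffZd d) k : ℤ) : ℝ)| * (1 / (96 * ρ * (B + 1))) ^ k
      ≤ 3 ^ (k + 1) * (16 * ρ * (B + 1)) ^ k * (1 / (96 * ρ * (B + 1))) ^ k := mul_le_mul_of_nonneg_right h1 (by positivity)
    _ = 3 * (3 * (16 * ρ * (B + 1) * (1 / (96 * ρ * (B + 1))))) ^ k := by
        rw [pow_succ, mul_pow 3, mul_pow (16 * ρ * (B + 1))]; ring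
    _ = 3 * (1 / 2) ^ k := by rw [hq]
    _ ≤ 3 := by
        have : (1 / 2 : ℝ) ^ k ≤ 1 := pow_le_one₀ (by norm_num) (by norm_num)
        linarith

/-- ★★ **Real-analyticity at `y = ∞` in every dimension**: `g_d = (largeForceSeriesZd d).sum` is analytic at `0` and
`g_d(1/y) = e^{λ_B(y)}/y` on `ℤ^{d+1}` for every `y ≥ 1/t*_d`. [cite: JansevanRensburgWhittington2013, §3.2 Theorem 8 (arXiv v4 p. 11)] -/
theorem analyticAt_largeForceSeriesZd_sum (d : ℕ) :
    AnalyticAt ℝ (largeForceSeriesZd d).sum 0 ∧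
      ∀ y ≥ (tStarZd d)⁻¹, (largeForceSeriesZd d).sum y⁻¹ = Real.exp (pulledBridgeFreeEnergy (d + 1) y) / y := by
  refine ⟨((largeForceSeriesZd d).hasFPowerSeriesOnBall (largeForceSeriesZd_radius_pos d)).analyticAt, fun y hy => ?_⟩
  have hy0 : 0 < y := lt_of_lt_of_le (inv_pos.2 (tStarZd_pos d)) hy
  have h1 : (largeForceSeriesZd d).sum y⁻¹ = ∑' k, (largeForceCoeffZd d k : ℝ) * y⁻¹ ^ k := by
    rw [largeForceSeriesZd, ← FormalMultilinearSeries.ofScalarsSum, FormalMultilinearSeries.ofScalars_sum_eq]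
    simp [smul_eq_mul]
  have h2 : HasSum (fun k => (largeForceCoeffZd d k : ℝ) * y⁻¹ ^ k) (Real.exp (pulledBridgeFreeEnergy (d + 1) y) / y) := by
    have h := (hasSum_largeForceCoeffZd d hy).mul_left y⁻¹
    have hfun : (fun k => y⁻¹ * (y * ((largeForceCoeffZd d k : ℝ) * y⁻¹ ^ k))) = fun k => (largeForceCoeffZd d k : ℝ) * y⁻¹ ^ k := by
      funext k; field_simp
    rw [hfun] at h
    rwa [div_eq_inv_mul]
  rw [h1, h2.tsum_eq]

/-- ★★ **`λ_B(y) − log y` is a real-analytic function of `1/y` at `y = ∞` on every `ℤ^{d+1}`, vanishing there.**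
[cite: JansevanRensburgWhittington2013, §3.2 Theorem 8 (arXiv v4 p. 11)] -/
theorem analyticAt_pulledBridgeFreeEnergy_sub_log_zd (d : ℕ) :
    AnalyticAt ℝ (fun t => Real.log ((largeForceSeriesZd d).sum t)) 0 ∧ Real.log ((largeForceSeriesZd d).sum 0) = 0 ∧
      ∀ y ≥ (tStarZd d)⁻¹, pulledBridgeFreeEnergy (d + 1) y = Real.log y + Real.log ((largeForceSeriesZd d).sum y⁻¹) := by
  obtain ⟨hg, hval⟩ := analyticAt_largeForceSeriesZd_sum d
  have hg0 : (largeForceSeriesZd d).sum 0 = 1 := by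
    have h := FormalMultilinearSeries.ofScalarsSum_zero (E := ℝ) (fun k => (largeForceCoeffZd d k : ℝ))
    rw [FormalMultilinearSeries.ofScalarsSum] at h
    rw [largeForceSeriesZd, h, largeForceCoeffZd_zero]
    simp
  refine ⟨?_, by rw [hg0, Real.log_one], fun y hy => ?_⟩
  · exact (analyticAt_log (by rw [hg0]; norm_num)).comp hg
  · have hy0 : 0 < y := lt_of_lt_of_le (inv_pos.2 (tStarZd_pos d)) hy
    rw [hval y hy, Real.log_div (Real.exp_pos _).ne' hy0.ne', Real.log_exp]
    ring

end Literature.Probability.RandomPlanarGeometry.SAW.Zd
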